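import Literature.AlgebraicGeometry.AbelianSchemes.AbelianSchemeSymplecticLevel
import Literature.AlgebraicGeometry.AbelianSchemes.LevelStructureTwist
import Literature.AlgebraicGeometry.AbelianSchemes.AbelianSchemeOverRestrictPt
import HarnessLib

/-!
# Twisting a symplectic lift of a level structure along a compatible tower of symplectic similitudes

Layer `Literature/AlgebraicGeometry/AbelianSchemes`, namespace
`Literature.AlgebraicGeometry.AbelianSchemes.AbelianSchemeOver.LevelStructure`.  Over the carriers D1
(`AbelianSchemeOver`, `LevelStructure`, `restrictPt`), D3 (`LevelStructure.SymplecticLift`, `IsSymplecticLiftable`,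
`typeFormMod`) and P31 (`LevelStructure.twist`, the right action `φ ↦ φ·γ̄` of `GL_{2g}(ℤ/N)` on level-`N` structures of
a COMMUTATIVE group scheme, [MFK94 Cor. 6.5] carried as the binder `[IsCommMonObj A.X]`):
* `map_ofAdd_eq_prod_pow` — a homomorphism out of `Multiplicative ((ℤ/M)^{2g})` is determined on the basis vectors;
* `SymplecticLift.exists_twist` — given a symplectic lift `Λ = (ζ_M, lift_M)_M` of `φ(s)` for the ample witness `Θ`
  and, for every `M`, a matrix `Γ_M ∈ GL_{2g}(ℤ/M)` and a unit `ν_M` that are COMPATIBLE under `ℤ/kM → ℤ/M` and such that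
  `Γ_M` is a similitude of `E_δ mod M` with multiplier `ν_M`, the tower `(ζ_M^{ν_M}, lift_M ∘ Γ_M)_M` is a symplectic
  lift of the twisted structure `φ·Γ_N`, with `lift′_M x = lift_M (Γ_M x)` — Deligne's action of `K = GSp(ẑ)` on the
  similitude classes `k : ẑ^{2g} ⥲ T̂(A_s)`, Milne's `η ↦ η ∘ γ`;
* `IsSymplecticLiftable.twist` — hence symplectic-liftability is preserved by such twists.
Purpose (cell `hodgecm-mathlib`, rung 0 on `hDel`, (P)-skeleton `M1primeOfFU` stub W4 «integral Hecke operators at the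
carrier»): the twisted universal triple `(univ.A, univ.pol, univ.level·γ̄_N)` is again an object of the moduli problem.
The towers `(Γ_M, ν_M)_M` of an element of `K_δ(1)` are supplied by
`ModuliOfAbelianVarieties/SiegelPrincipalLevelSimilitudeTower`.  Theorems only; no `def`, no named fact, no instance.

## References
* P. Deligne, *Travaux de Shimura*, Sém. Bourbaki 389 (1971), 4.12 (b) p. 149. [Deligne1971TravauxShimura]
* J. S. Milne, *Introduction to Shimura Varieties* (2005), §6 (63) p. 116 and Thm. 6.11, p. 75.
  [Milne2005ShimuraVarieties]
* K.-W. Lan, *Arithmetic Compactifications of PEL-Type Shimura Varieties* (2013), §1.3.6 Lemma 1.3.6.6 (pp. 81–82).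
  [Lan2013PELCompactifications]
-/

noncomputable section

universe u

open CategoryTheory CategoryTheory.Limits AlgebraicGeometry MonoidalCategory Matrix
open scoped MonObj

namespace Literature.AlgebraicGeometry.AbelianSchemes.AbelianSchemeOver

open CategoryTheory AlgebraicGeometry Matrix Literature.AlgebraicGeometry.Motives
open scoped MonObj CategoryTheory.Obj

variable {S : Scheme.{u}} {A : AbelianSchemeOver S} {g N : ℕ}

/-- A monoid homomorphism out of `Multiplicative ((ℤ/M)^{2g})`, `M ≥ 1`, is determined by its values on the basis
vectors: `L(a) = ∏ₖ L(eₖ)^{aₖ}` (with `aₖ` read in `{0,…,M-1}`). [folklore] -/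
private theorem map_ofAdd_eq_prod_pow {M : ℕ} [NeZero M] {H : Type*} [CommMonoid H]
    (L : Multiplicative (Fin g ⊕ Fin g → ZMod M) →* H) (a : Fin g ⊕ Fin g → ZMod M) :
    L (Multiplicative.ofAdd a) = ∏ k, L (Multiplicative.ofAdd (Pi.single k 1)) ^ (a k).val := by
  have ha : a = ∑ k, (a k).val • (Pi.single k (1 : ZMod M)) := by
    funext i
    simp only [Finset.sum_apply, Pi.smul_apply, Pi.single_apply]
    rw [Finset.sum_eq_single i (fun k _ hk => by simp [Ne.symm hk]) (by simp)]
    simp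
  conv_lhs => rw [ha]
  rw [ofAdd_sum, map_prod]
  refine Finset.prod_congr rfl fun k _ => ?_
  rw [ofAdd_nsmul, map_pow]

namespace LevelStructure.SymplecticLift

variable [IsCommMonObj A.X] [NeZero N] {φ : A.LevelStructure g N} {Ω : Type u} [Field Ω]
  {s : Spec (.of Ω) ⟶ S} {Θ : Motives.CartierDivisor (A.fibre s).toAbelianVariety.X.left} {δ : Fin g → ℕ}

/-- `x ↦ G x` on the multiplicative copy of `(ℤ/M)^{2g}` (Mathlib's `mulVecLin`, made multiplicative) evaluates
as `ofAdd x ↦ ofAdd (G x)`. [folklore] -/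
private theorem toMultiplicative_mulVecLin_ofAdd {M : ℕ} (G : Matrix (Fin g ⊕ Fin g) (Fin g ⊕ Fin g) (ZMod M))
    (x : Fin g ⊕ Fin g → ZMod M) :
    AddMonoidHom.toMultiplicative (Matrix.mulVecLin G).toAddMonoidHom (Multiplicative.ofAdd x) =
      Multiplicative.ofAdd (G *ᵥ x) := rfl

/-- **Twisting a symplectic lift along a compatible tower of symplectic similitudes** ([Deligne1971TravauxShimura]
4.12 (b): `K = GSp(ẑ)` acts on the similitude classes `k`; [Milne2005ShimuraVarieties] (63) `η ↦ η ∘ g`): given a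
symplectic lift `Λ` of `φ(s)` and, for every level `M`, a matrix `Γ_M ∈ GL_{2g}(ℤ/M)` and a unit `ν_M` such that the
`Γ_M`, `ν_M` are compatible under the reductions `ℤ/kM → ℤ/M` and `Γ_M` is a similitude of `E_δ` mod `M` with multiplier
`ν_M`, the tower `lift_M ∘ Γ_M` with the roots `ζ_M^{ν_M}` is a symplectic lift of the TWISTED level structure `φ · Γ_N`.
[cite: Deligne1971TravauxShimura, 4.12 (b) p. 149] [cite: Milne2005ShimuraVarieties, §6 (63) and p. 75] -/
theorem exists_twist (Λ : φ.SymplecticLift s Θ δ)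
    (Γ : ∀ M : ℕ, GL (Fin g ⊕ Fin g) (ZMod M)) (ν : ∀ M : ℕ, (ZMod M)ˣ)
    (hΓ : ∀ ⦃M : ℕ⦄ (k : ℕ), N ∣ M → M ≠ 0 → k ≠ 0 → ∀ i j,
      ZMod.castHom (Dvd.intro_left k rfl) (ZMod M)
          ((Γ (k * M) : Matrix (Fin g ⊕ Fin g) (Fin g ⊕ Fin g) (ZMod (k * M))) i j) =
        (Γ M : Matrix (Fin g ⊕ Fin g) (Fin g ⊕ Fin g) (ZMod M)) i j)
    (hν : ∀ ⦃M : ℕ⦄ (k : ℕ), N ∣ M → M ≠ 0 → k ≠ 0 →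
      ZMod.castHom (Dvd.intro_left k rfl) (ZMod M) ((ν (k * M) : ZMod (k * M))) = (ν M : ZMod M))
    (hsim : ∀ ⦃M : ℕ⦄, N ∣ M → M ≠ 0 → ∀ x y : Fin g ⊕ Fin g → ZMod M,
      typeFormMod δ M ((Γ M : Matrix (Fin g ⊕ Fin g) (Fin g ⊕ Fin g) (ZMod M)) *ᵥ x)
          ((Γ M : Matrix (Fin g ⊕ Fin g) (Fin g ⊕ Fin g) (ZMod M)) *ᵥ y) =
        (ν M : ZMod M) * typeFormMod δ M x y) :
    ∃ Λ' : (φ.twist (Γ N)).SymplecticLift s Θ δ, ∀ (M : ℕ) (x : Fin g ⊕ Fin g → ZMod M),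
      ((Λ'.lift M (Multiplicative.ofAdd x)) : (A.fibre s).toAbelianVariety.Points Ω) =
        Λ.lift M (Multiplicative.ofAdd ((Γ M : Matrix (Fin g ⊕ Fin g) (Fin g ⊕ Fin g) (ZMod M)) *ᵥ x)) := by
  classical
  refine ⟨{
    ζ := fun M => Λ.ζ M ^ ((ν M : ZMod M)).val
    isPrimitiveRoot_ζ := fun M hM hM0 => ?_
    ζ_pow := fun M k hM hM0 hk => ?_
    lift := fun M => (Λ.lift M).comp
      (AddMonoidHom.toMultiplicative (Matrix.mulVecLin (Γ M : Matrix (Fin g ⊕ Fin g) (Fin g ⊕ Fin g) (ZMod M))).toAddMonoidHom)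
    lift_bijective := fun M hM hM0 => ?_
    lift_compat := fun M k x hM hM0 hk => ?_
    lift_level := fun i => ?_
    pairing := fun M hM hMΩ x y => ?_ }, fun M x => rfl⟩
  · -- `ζ_M^{ν_M}` is again primitive: `ν_M` is a unit mod `M`
    haveI : NeZero M := ⟨hM0⟩
    exact (Λ.isPrimitiveRoot_ζ hM hM0).pow_of_coprime _ (ZMod.val_coe_unit_coprime (ν M))
  · -- compatibility of the roots: `(ζ_{kM}^{ν_{kM}})^k = ζ_M^{ν_M}`
    haveI : NeZero M := ⟨hM0⟩
    haveI : NeZero (k * M) := ⟨Nat.mul_ne_zero hk hM0⟩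
    have hval : ((ν (k * M) : ZMod (k * M))).val % M = ((ν M : ZMod M)).val := by
      have h := hν k hM hM0 hk
      rw [ZMod.castHom_apply, ZMod.cast_eq_val] at h
      rw [← h, ZMod.val_natCast]
    rw [← pow_mul, mul_comm ((ν (k * M) : ZMod (k * M))).val k, pow_mul, Λ.ζ_pow k hM hM0 hk, ← hval]
    conv_lhs => rw [← Nat.mod_add_div ((ν (k * M) : ZMod (k * M))).val M]
    rw [pow_add, pow_mul, Λ.ζ_pow_eq_one hM hM0, one_pow, mul_one]
  · -- bijectivity: `Γ_M` is invertible
    refine (Λ.lift_bijective hM hM0).comp ⟨fun x y hxy => ?_, fun y => ?_⟩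
    · have h := congrArg (fun z => AddMonoidHom.toMultiplicative
        (Matrix.mulVecLin ((Γ M)⁻¹ : Matrix (Fin g ⊕ Fin g) (Fin g ⊕ Fin g) (ZMod M))).toAddMonoidHom z) hxy
      simpa [Matrix.mulVec_mulVec, ← Units.val_mul] using h
    · refine ⟨AddMonoidHom.toMultiplicative
        (Matrix.mulVecLin ((Γ M)⁻¹ : Matrix (Fin g ⊕ Fin g) (Fin g ⊕ Fin g) (ZMod M))).toAddMonoidHom y, ?_⟩
      simp [Matrix.mulVec_mulVec]
  · -- compatibility of the tower: reduce `Γ_{kM} x` mod `M`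
    haveI : NeZero M := ⟨hM0⟩
    have hcast : (fun i => ZMod.castHom (Dvd.intro_left k rfl) (ZMod M)
        (((Γ (k * M) : Matrix (Fin g ⊕ Fin g) (Fin g ⊕ Fin g) (ZMod (k * M))) *ᵥ x) i)) =
        (Γ M : Matrix (Fin g ⊕ Fin g) (Fin g ⊕ Fin g) (ZMod M)) *ᵥ
          fun i => ZMod.castHom (Dvd.intro_left k rfl) (ZMod M) (x i) := by
      have hm : (Γ (k * M) : Matrix (Fin g ⊕ Fin g) (Fin g ⊕ Fin g) (ZMod (k * M))).map
          (ZMod.castHom (Dvd.intro_left k rfl) (ZMod M)) =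
          (Γ M : Matrix (Fin g ⊕ Fin g) (Fin g ⊕ Fin g) (ZMod M)) := by
        ext i' j'
        exact hΓ k hM hM0 hk i' j'
      funext i
      rw [RingHom.map_mulVec, hm]
      rfl
    simp only [MonoidHom.coe_comp, Function.comp_apply, toMultiplicative_mulVecLin_ofAdd]
    rw [← hcast]
    exact Λ.lift_compat k _ hM hM0 hk
  · -- at level `N`: `lift_N (Γ_N eᵢ) = (φ·Γ_N).σᵢ (s)`
    simp only [MonoidHom.coe_comp, Function.comp_apply, toMultiplicative_mulVecLin_ofAdd, Matrix.mulVec_single_one,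
      LevelStructure.twist_σ]
    rw [map_ofAdd_eq_prod_pow, Subgroup.val_finsetProd]
    simp_rw [SubgroupClass.coe_pow, Λ.lift_level]
    rw [A.restrictPt_sectionPow, Fintype.prod_sum_type]
    letI : CommGroup (Motives.AlgPoints (A.fibre s).X Ω) :=
      inferInstanceAs (CommGroup ((A.fibre s).toAbelianVariety.Points Ω))
    congr 1
    · exact List.prod_ofFn.symm
    · exact List.prod_ofFn.symm
  · -- the pairing: `ē(lift Γx, lift Γy) = ζ^{E(Γx,Γy)} = ζ^{ν E(x,y)} = (ζ^ν)^{E(x,y)}`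
    have hM0 : M ≠ 0 := by rintro rfl; exact hMΩ (by simp)
    haveI : NeZero M := ⟨hM0⟩
    simp only [MonoidHom.coe_comp, Function.comp_apply, toMultiplicative_mulVecLin_ofAdd]
    rw [Λ.pairing hM hMΩ, hsim hM hM0, ← pow_mul, ZMod.val_mul]
    conv_rhs => rw [← Nat.mod_add_div (((ν M : ZMod M)).val * (typeFormMod δ M x y).val) M]
    rw [pow_add, pow_mul, Λ.ζ_pow_eq_one hM hM0, one_pow, mul_one]

end LevelStructure.SymplecticLift

end Literature.AlgebraicGeometry.AbelianSchemes.AbelianSchemeOver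

namespace Literature.AlgebraicGeometry.AbelianSchemes.AbelianSchemeOver.LevelStructure.IsSymplecticLiftable

open CategoryTheory AlgebraicGeometry Matrix

variable {S : Scheme.{u}} {A : AbelianSchemeOver S} {g N : ℕ} [IsCommMonObj A.X] [NeZero N]
  {φ : A.LevelStructure g N} {D : A.DualPair} {pol : A.Polarization D} {δ : Fin g → ℕ}

/-- **A symplectic-liftable level structure twisted along a compatible tower of similitudes of `E_δ` is again
symplectic-liftable** (pointwise: `SymplecticLift.exists_twist` at every geometric point and every ample witness; the
tower is indexed by all `M ≠ 0`). [cite: Deligne1971TravauxShimura, 4.12 (b) p. 149]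
[cite: Lan2013PELCompactifications, §1.3.6 Lemma 1.3.6.6 (pp. 81–82)] -/
theorem twist (h : φ.IsSymplecticLiftable pol δ)
    (Γ : ∀ M : ℕ, GL (Fin g ⊕ Fin g) (ZMod M)) (ν : ∀ M : ℕ, (ZMod M)ˣ)
    (hΓ : ∀ ⦃M : ℕ⦄ (k : ℕ), M ≠ 0 → k ≠ 0 → ∀ i j,
      ZMod.castHom (Dvd.intro_left k rfl) (ZMod M)
          ((Γ (k * M) : Matrix (Fin g ⊕ Fin g) (Fin g ⊕ Fin g) (ZMod (k * M))) i j) =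
        (Γ M : Matrix (Fin g ⊕ Fin g) (Fin g ⊕ Fin g) (ZMod M)) i j)
    (hν : ∀ ⦃M : ℕ⦄ (k : ℕ), M ≠ 0 → k ≠ 0 →
      ZMod.castHom (Dvd.intro_left k rfl) (ZMod M) ((ν (k * M) : ZMod (k * M))) = (ν M : ZMod M))
    (hsim : ∀ ⦃M : ℕ⦄, M ≠ 0 → ∀ x y : Fin g ⊕ Fin g → ZMod M,
      typeFormMod δ M ((Γ M : Matrix (Fin g ⊕ Fin g) (Fin g ⊕ Fin g) (ZMod M)) *ᵥ x)
          ((Γ M : Matrix (Fin g ⊕ Fin g) (Fin g ⊕ Fin g) (ZMod M)) *ᵥ y) =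
        (ν M : ZMod M) * typeFormMod δ M x y) :
    (φ.twist (Γ N)).IsSymplecticLiftable pol δ := by
  intro Ω _ _ s Θ hΘ hlam
  obtain ⟨Λ⟩ := h Ω s Θ hΘ hlam
  obtain ⟨Λ', -⟩ := Λ.exists_twist Γ ν (fun M k _ hM0 hk => hΓ k hM0 hk) (fun M k _ hM0 hk => hν k hM0 hk)
    (fun M _ hM0 => hsim hM0)
  exact ⟨Λ'⟩

end Literature.AlgebraicGeometry.AbelianSchemes.AbelianSchemeOver.LevelStructure.IsSymplecticLiftable
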